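import Summits.QuantumFields.YangMills.Theorems.UnitScaleGibbsActionDerivativeSlotCalculusRight
import Summits.QuantumFields.YangMills.Theorems.UnitScaleGibbsActionDerivativeFlowHessian
import Literature.MathematicalPhysics.QuantumFieldTheory.Balaban1983to89.Node00.CriticalOnFibreTangent
import Mathlib.Analysis.Calculus.Deriv.Shift
import HarnessLib

/-!
# The RIGHT-chart slot calculus — THE DERIVATIVES: `X^R_u = actionDerivR` IS `(d∕dt) A(U·e^{tu})∣₀`, its one-bond rows, the sums, the summed right Hessian
# `actionDeriv₂R = (d∕dt)² A(U·e^{tu})∣₀ = deriv (deriv (t ↦ A(Node00.expChart U (t•Y)))) 0`, continuity — (SD-R)(ii)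

Sequel of `UnitScaleGibbsActionDerivativeSlotCalculusRight` (same seat `ym3-torus-px17` gen 7, same namespace; crux of record `UnitScaleTilt.HistoryTailL` stmt-QuantumFields-19936 ∕
LINE 28 on stmt-QuantumFields-23083; cell `ym3-torus` = YM ladder rung R3 — a RUNG, NOT the Clay problem).  Mirror of ✓ `…SlotDerivatives` ∕ `…FlowHessian` §1–§2 for the RIGHT shift
`U ↦ U[b ↦ U_b·k b t]` (px8 g9's (SD-R)(i) identity consumes exactly these rows) and the simultaneous right flow `e ↦ U_e·k e t`, which for `SU(N)` IS Node00's
`expChart U (t•Y)` (`CriticalOnFibreTangent.expChart U X = fun b => U b * expSU (X b)`) — the currency of px10 g7's ✓ `UnitScaleGibbsOnEventHessianAxialGauge`.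

* §3 ★★ `hasDerivAt_wilsonAction4_flow_right`, ★★ `hasDerivAt_wilsonAction4_oneBond_right : HasDerivAt (t ↦ A(U[b ↦ U_b·k b t])) (oneBondDerivR ρ u b U) 0`, ★ `sum_oneBondDerivR`;
* §4 ★★ `hasDerivAt_actionDerivR_oneBond_right`, ★ `sum_oneBondDeriv₂R`, ★★ `hasDerivAt_actionDerivR_flow_right`, ★ `hasDerivAt_wilsonAction4_flow_right_at`,
  ★★★ `deriv_deriv_wilsonAction4_flow_right : deriv (deriv (s ↦ A(e ↦ U_e·k e s))) 0 = actionDeriv₂R ρ u U`;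
* §5 continuity of `actionDerivR`, `oneBondDerivR b`, `actionDeriv₂R`, `oneBondDeriv₂R b`;
* §6 (`SU(N)`) ★★★ `actionDeriv₂R_eq_deriv_deriv_expChart : actionDeriv₂R (fundamentalRep (Fin N)) (b ↦ ↑(Y b)) U = deriv (deriv fun t => wilsonAction4 (expChart U (t • Y))) 0`
  and ★★ `actionDerivR_eq_deriv_expChart` — Node00's right-chart `Q_U(Y)` VERBATIM.

HONEST SCOPE.  Finite-dimensional calculus; nothing of LINE 28's registered stubs, «ShallowFluxSecondMomentL», (Q), K1, `MeanDeviationL`, `HistoryTailL`, R3, d = 4, a continuum limit or a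
mass gap is proved; the Yang–Mills mass gap is NOT proved.  THEOREMS ONLY (0 `def`, 0 `sorry`); `--supports stmt-QuantumFields-19936 --as helper`.

References: M. Creutz, Quarks, Gluons and Lattices (2022) Ch. 11 [Creutz2022]; T. Bałaban, CMP 99 (1985) 389–434, (3.6)–(3.7) p.391 [Balaban1985BackgroundPropagators];
L. Gross, CMP 92 (1983) 137–162, proof of Thm 2.2 [GrossCMP1983].
-/

set_option autoImplicit false

noncomputable section

open MeasureTheory Filter Topology NormedSpace
open scoped BigOperators
open Literature.MathematicalPhysics.QuantumFieldTheory.Balaban1983to89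
open Literature.MathematicalPhysics.QuantumLattice (fundamentalRep)
open Summit.QuantumFields.YangMills.Cruxes.CurvatureAmnesia.WardDefect.SchwingerDyson (hasDerivAt_reTrace)
open Summit.QuantumFields.YangMills.Theorems.UnitScaleGibbsActionDerivativeSlotCalculus

namespace Summit.QuantumFields.YangMills.Theorems.UnitScaleGibbsActionDerivativeSlotCalculusRight

/-! ## §3 The action along the simultaneous right flow and along one bond -/

section Action

open scoped Matrix.Norms.Frobenius

variable {N : ℕ} {P : Params} {j : ℕ} {G : Type} [GaugeGroup G]
  {ρ : G →* Matrix (Fin N) (Fin N) ℂ} {u : PBond P j → Matrix (Fin N) (Fin N) ℂ} {k : PBond P j → ℝ → G}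

/-- ★★ **`X^R_u = actionDerivR` IS THE DERIVATIVE OF THE ACTION ALONG THE SIMULTANEOUS RIGHT FLOW** `U ↦ (e ↦ U_e·k e t)`. [cite: GrossCMP1983, Thm 2.2 (proof); Creutz2022, Ch. 11] -/
theorem hasDerivAt_wilsonAction4_flow_right (hre : ∀ g : G, reTr g = (ρ g).trace.re / N)
    (hk : ∀ b s t, k b (s + t) = k b s * k b t) (hkX : ∀ b t, ρ (k b t) = exp ((t : ℂ) • u b)) (U : GaugeField P j G) :
    HasDerivAt (fun t : ℝ => wilsonAction4 (fun e => U e * k e t)) (actionDerivR ρ u U) 0 := by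
  have hfun : (fun t : ℝ => wilsonAction4 (fun e => U e * k e t)) = fun t : ℝ =>
      ∑ p : Plaq P j, (1 : ℝ) * (1 - (word (slot ρ (fun e => U e * k e t) p)).trace.re / N) := by
    funext t
    unfold wilsonAction4 wilsonAction
    simp only [hre, rho_plaqHol_eq_word]
  rw [hfun]
  unfold actionDerivR
  refine HasDerivAt.fun_sum fun p _ => ?_
  have hw := hasDerivAt_word (S := fun t => slot ρ (fun e => U e * k e t) p) (D := slotInsR ρ u U p)
    (fun i => hasDerivAt_slot_flow_right hk hkX U p i)
  rw [flow_right_zero hk U] at hw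
  have h := (((hasDerivAt_reTrace hw).div_const (N : ℝ)).const_sub (1 : ℝ)).const_mul (1 : ℝ)
  refine h.congr_deriv ?_
  rw [Matrix.trace_sum, Complex.re_sum, Finset.sum_div, one_mul, Finset.sum_neg_distrib]

variable [DecidableEq (PBond P j)]

/-- ★★ **THE ONE-BOND RIGHT ROWS OF THE ACTION**: along `U ↦ U[b ↦ U_b·k b t]`, `t ↦ A` has derivative `oneBondDerivR ρ u b U` at `0` — the `A′` row of px8 g9's right-shift
Schwinger–Dyson identity. [cite: Creutz2022, Ch. 11; GrossCMP1983, Thm 2.2 (proof)] -/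
theorem hasDerivAt_wilsonAction4_oneBond_right (hre : ∀ g : G, reTr g = (ρ g).trace.re / N)
    (hk : ∀ b s t, k b (s + t) = k b s * k b t) (hkX : ∀ b t, ρ (k b t) = exp ((t : ℂ) • u b)) (b : PBond P j) (U : GaugeField P j G) :
    HasDerivAt (fun t : ℝ => wilsonAction4 (Function.update U b (U b * k b t))) (oneBondDerivR ρ u b U) 0 := by
  have hfun : (fun t : ℝ => wilsonAction4 (Function.update U b (U b * k b t))) = fun t : ℝ =>
      ∑ p : Plaq P j, (1 : ℝ) * (1 - (word (slot ρ (Function.update U b (U b * k b t)) p)).trace.re / N) := by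
    funext t
    unfold wilsonAction4 wilsonAction
    simp only [hre, rho_plaqHol_eq_word]
  rw [hfun]
  unfold oneBondDerivR
  refine HasDerivAt.fun_sum fun p _ => ?_
  have hw := hasDerivAt_word (S := fun t => slot ρ (Function.update U b (U b * k b t)) p)
    (D := fun i => if slotBond p i = b then slotInsR ρ u U p i else 0) (fun i => hasDerivAt_slot_oneBond_right hk hkX b U p i)
  rw [update_mul_right_zero hk b U] at hw
  have h := (((hasDerivAt_reTrace hw).div_const (N : ℝ)).const_sub (1 : ℝ)).const_mul (1 : ℝ)
  refine h.congr_deriv ?_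
  rw [Matrix.trace_sum, Complex.re_sum, Finset.sum_div, one_mul, ← Finset.sum_neg_distrib]
  refine Finset.sum_congr rfl fun i _ => ?_
  split_ifs with hb
  · rfl
  · rw [word_update_zero]; simp

/-- ★ **`Σ_b A′^R_b = X^R_u`.** [cite: GrossCMP1983, Thm 2.2 (proof)] -/
theorem sum_oneBondDerivR (U : GaugeField P j G) : ∑ b, oneBondDerivR ρ u b U = actionDerivR ρ u U := by
  unfold oneBondDerivR actionDerivR
  rw [Finset.sum_comm]
  refine Finset.sum_congr rfl fun p _ => ?_
  rw [Finset.sum_comm]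
  refine Finset.sum_congr rfl fun i _ => ?_
  exact Finset.sum_ite_eq _ _ _ |>.trans (if_pos (Finset.mem_univ _))

/-! ## §4 The derivative of `X^R_u` along one bond and along the flow -/

/-- The slots of the right once-inserted word along the one-bond right shift. [cite: Creutz2022, Ch. 11] -/
theorem hasDerivAt_insSlotR_oneBond_right (hk : ∀ b s t, k b (s + t) = k b s * k b t) (hkX : ∀ b t, ρ (k b t) = exp ((t : ℂ) • u b))
    (b : PBond P j) (U : GaugeField P j G) (p : Plaq P j) (i l : Fin 4) :
    HasDerivAt (fun t : ℝ => Function.update (slot ρ (Function.update U b (U b * k b t)) p) i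
        (slotInsR ρ u (Function.update U b (U b * k b t)) p i) l)
      (if slotBond p l = b then (if l = i then slotIns₂R ρ u U p i else slotInsR ρ u U p l) else 0) 0 := by
  by_cases hl : l = i
  · subst hl
    simp only [Function.update_self, if_true]
    exact hasDerivAt_slotInsR_oneBond_right hk hkX b U p l
  · simp only [Function.update_of_ne hl, hl, if_false]
    exact hasDerivAt_slot_oneBond_right hk hkX b U p l

/-- ★★ **THE ONE-BOND RIGHT ROWS OF `X^R_u`**: along `U ↦ U[b ↦ U_b·k b t]`, `t ↦ actionDerivR ρ u` has derivative `oneBondDeriv₂R ρ u b U` at `0`.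
[cite: GrossCMP1983, Thm 2.2 (proof); Creutz2022, Ch. 11] -/
theorem hasDerivAt_actionDerivR_oneBond_right (hk : ∀ b s t, k b (s + t) = k b s * k b t) (hkX : ∀ b t, ρ (k b t) = exp ((t : ℂ) • u b))
    (b : PBond P j) (U : GaugeField P j G) :
    HasDerivAt (fun t : ℝ => actionDerivR ρ u (Function.update U b (U b * k b t))) (oneBondDeriv₂R ρ u b U) 0 := by
  unfold actionDerivR oneBondDeriv₂R
  refine HasDerivAt.fun_sum fun p _ => HasDerivAt.fun_sum fun i _ => ?_
  have hw := hasDerivAt_word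
    (S := fun t => Function.update (slot ρ (Function.update U b (U b * k b t)) p) i (slotInsR ρ u (Function.update U b (U b * k b t)) p i))
    (D := fun l => if slotBond p l = b then (if l = i then slotIns₂R ρ u U p i else slotInsR ρ u U p l) else 0)
    (fun l => hasDerivAt_insSlotR_oneBond_right hk hkX b U p i l)
  rw [update_mul_right_zero hk b U] at hw
  have h : HasDerivAt (fun t : ℝ => -((word (Function.update (slot ρ (Function.update U b (U b * k b t)) p) i
        (slotInsR ρ u (Function.update U b (U b * k b t)) p i))).trace.re / (N : ℝ)))
      (-((∑ l, word (Function.update (Function.update (slot ρ U p) i (slotInsR ρ u U p i)) l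
        (if slotBond p l = b then (if l = i then slotIns₂R ρ u U p i else slotInsR ρ u U p l) else 0))).trace.re / (N : ℝ))) 0 :=
    ((hasDerivAt_reTrace hw).div_const (N : ℝ)).neg
  refine h.congr_deriv ?_
  rw [Matrix.trace_sum, Complex.re_sum, Finset.sum_div, ← Finset.sum_neg_distrib]
  refine Finset.sum_congr rfl fun l _ => ?_
  unfold word₂R
  by_cases hb : slotBond p l = b
  · rw [if_pos hb, if_pos hb]
  · rw [if_neg hb, if_neg hb, word_update_zero]; simp

/-- ★ **`Σ_b X′^R_b = actionDeriv₂R`.** [cite: GrossCMP1983, Thm 2.2 (proof)] -/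
theorem sum_oneBondDeriv₂R (U : GaugeField P j G) : ∑ b, oneBondDeriv₂R ρ u b U = actionDeriv₂R ρ u U := by
  unfold oneBondDeriv₂R actionDeriv₂R
  rw [Finset.sum_comm]
  refine Finset.sum_congr rfl fun p _ => ?_
  rw [Finset.sum_comm]
  refine Finset.sum_congr rfl fun i _ => ?_
  rw [Finset.sum_comm]
  refine Finset.sum_congr rfl fun l _ => ?_
  exact Finset.sum_ite_eq _ _ _ |>.trans (if_pos (Finset.mem_univ _))

omit [DecidableEq (PBond P j)] in
/-- The slots of the right once-inserted word along the simultaneous right flow. [cite: Creutz2022, Ch. 11] -/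
theorem hasDerivAt_insSlotR_flow_right (hk : ∀ b s t, k b (s + t) = k b s * k b t) (hkX : ∀ b t, ρ (k b t) = exp ((t : ℂ) • u b))
    (U : GaugeField P j G) (p : Plaq P j) (i l : Fin 4) :
    HasDerivAt (fun t : ℝ => Function.update (slot ρ (fun e => U e * k e t) p) i (slotInsR ρ u (fun e => U e * k e t) p i) l)
      (if l = i then slotIns₂R ρ u U p i else slotInsR ρ u U p l) 0 := by
  by_cases hl : l = i
  · subst hl
    simp only [Function.update_self, if_true]
    exact hasDerivAt_slotInsR_flow_right hk hkX U p l
  · simp only [Function.update_of_ne hl, hl, if_false]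
    exact hasDerivAt_slot_flow_right hk hkX U p l

omit [DecidableEq (PBond P j)] in
/-- ★★ **`actionDeriv₂R` IS THE DERIVATIVE OF `actionDerivR` ALONG THE SIMULTANEOUS RIGHT FLOW.** [cite: GrossCMP1983, Thm 2.2 (proof); Creutz2022, Ch. 11] -/
theorem hasDerivAt_actionDerivR_flow_right (hk : ∀ b s t, k b (s + t) = k b s * k b t) (hkX : ∀ b t, ρ (k b t) = exp ((t : ℂ) • u b))
    (U : GaugeField P j G) :
    HasDerivAt (fun t : ℝ => actionDerivR ρ u (fun e => U e * k e t)) (actionDeriv₂R ρ u U) 0 := by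
  classical
  unfold actionDerivR actionDeriv₂R
  refine HasDerivAt.fun_sum fun p _ => HasDerivAt.fun_sum fun i _ => ?_
  have hw := hasDerivAt_word
    (S := fun t => Function.update (slot ρ (fun e => U e * k e t) p) i (slotInsR ρ u (fun e => U e * k e t) p i))
    (D := fun l => if l = i then slotIns₂R ρ u U p i else slotInsR ρ u U p l)
    (fun l => hasDerivAt_insSlotR_flow_right hk hkX U p i l)
  rw [flow_right_zero hk U] at hw
  have h : HasDerivAt (fun t : ℝ => -((word (Function.update (slot ρ (fun e => U e * k e t) p) i
        (slotInsR ρ u (fun e => U e * k e t) p i))).trace.re / (N : ℝ)))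
      (-((∑ l, word (Function.update (Function.update (slot ρ U p) i (slotInsR ρ u U p i)) l
        (if l = i then slotIns₂R ρ u U p i else slotInsR ρ u U p l))).trace.re / (N : ℝ))) 0 :=
    ((hasDerivAt_reTrace hw).div_const (N : ℝ)).neg
  refine h.congr_deriv ?_
  rw [Matrix.trace_sum, Complex.re_sum, Finset.sum_div, ← Finset.sum_neg_distrib]
  rfl

omit [DecidableEq (PBond P j)] in
/-- Right flows compose: `e ↦ (U_e·k e t)·k e s` is the flow at time `t + s`. [folklore] -/
theorem flow_right_mul_flow (hk : ∀ b s t, k b (s + t) = k b s * k b t) (U : GaugeField P j G) (s t : ℝ) :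
    (fun e => U e * k e t * k e s) = fun e => U e * k e (t + s) :=
  funext fun e => by rw [hk, mul_assoc]

omit [DecidableEq (PBond P j)] in
/-- ★ The first right derivative at EVERY time. [cite: GrossCMP1983, Thm 2.2 (proof)] -/
theorem hasDerivAt_wilsonAction4_flow_right_at (hre : ∀ g : G, reTr g = (ρ g).trace.re / N)
    (hk : ∀ b s t, k b (s + t) = k b s * k b t) (hkX : ∀ b t, ρ (k b t) = exp ((t : ℂ) • u b)) (U : GaugeField P j G) (t : ℝ) :
    HasDerivAt (fun s : ℝ => wilsonAction4 (fun e => U e * k e s)) (actionDerivR ρ u (fun e => U e * k e t)) t := by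
  have h0 := hasDerivAt_wilsonAction4_flow_right (u := u) hre hk hkX (fun e => U e * k e t)
  have hfun : (fun s : ℝ => wilsonAction4 (fun e => U e * k e t * k e s)) = fun s : ℝ => wilsonAction4 (fun e => U e * k e (s + t)) := by
    funext s; rw [flow_right_mul_flow hk U s t, add_comm]
  rw [hfun] at h0
  have h1 : HasDerivAt (fun s : ℝ => wilsonAction4 (fun e => U e * k e (s + t))) (actionDerivR ρ u (fun e => U e * k e t)) (t - t) := by
    rw [sub_self]; exact h0
  have h2 := HasDerivAt.comp_sub_const t t h1
  simp only [sub_add_cancel] at h2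
  exact h2

omit [DecidableEq (PBond P j)] in
/-- ★★★ **THE SECOND DERIVATIVE OF THE ACTION ALONG THE SIMULTANEOUS RIGHT FLOW IS `actionDeriv₂R`.** [cite: GrossCMP1983, Thm 2.2 (proof); Balaban1985BackgroundPropagators, (3.7) p.391] -/
theorem deriv_deriv_wilsonAction4_flow_right (hre : ∀ g : G, reTr g = (ρ g).trace.re / N)
    (hk : ∀ b s t, k b (s + t) = k b s * k b t) (hkX : ∀ b t, ρ (k b t) = exp ((t : ℂ) • u b)) (U : GaugeField P j G) :
    deriv (deriv (fun s : ℝ => wilsonAction4 (fun e => U e * k e s))) 0 = actionDeriv₂R ρ u U := by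
  have hd : deriv (fun s : ℝ => wilsonAction4 (fun e => U e * k e s)) = fun t => actionDerivR ρ u (fun e => U e * k e t) :=
    funext fun t => (hasDerivAt_wilsonAction4_flow_right_at hre hk hkX U t).deriv
  rw [hd]
  exact (hasDerivAt_actionDerivR_flow_right hk hkX U).deriv

omit [DecidableEq (PBond P j)] in
/-- ★★ `deriv (s ↦ A(rightflow_s U)) 0 = actionDerivR ρ u U`. [cite: GrossCMP1983, Thm 2.2 (proof)] -/
theorem deriv_wilsonAction4_flow_right_zero (hre : ∀ g : G, reTr g = (ρ g).trace.re / N)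
    (hk : ∀ b s t, k b (s + t) = k b s * k b t) (hkX : ∀ b t, ρ (k b t) = exp ((t : ℂ) • u b)) (U : GaugeField P j G) :
    deriv (fun s : ℝ => wilsonAction4 (fun e => U e * k e s)) 0 = actionDerivR ρ u U := by
  rw [(hasDerivAt_wilsonAction4_flow_right hre hk hkX U).deriv]

end Action

/-! ## §5 Continuity in the configuration -/

section Continuity

open scoped Matrix.Norms.Frobenius

variable {N : ℕ} {P : Params} {j : ℕ} {G : Type} [GaugeGroup G] [TopologicalSpace G] [IsTopologicalGroup G]
  {ρ : G →* Matrix (Fin N) (Fin N) ℂ} (hρ : Continuous ρ) (u : PBond P j → Matrix (Fin N) (Fin N) ℂ)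

include hρ

/-- Each right first insertion is continuous in `U`. [folklore] -/
theorem continuous_slotInsR (p : Plaq P j) (i : Fin 4) : Continuous fun U : GaugeField P j G => slotInsR ρ u U p i := by
  have hd : ∀ e : PBond P j, Continuous fun U : GaugeField P j G => ρ (U e) * u e :=
    fun e => (hρ.comp (continuous_apply e)).mul continuous_const
  have hi : ∀ e : PBond P j, Continuous fun U : GaugeField P j G => (-u e) * ρ ((U e)⁻¹) :=
    fun e => continuous_const.mul (hρ.comp ((continuous_apply e).inv))
  fin_cases i
  · simpa [slotInsR] using hd ⟨p.src, p.μ⟩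
  · simpa [slotInsR] using hd ⟨p.src.shift p.μ, p.ν⟩
  · simpa [slotInsR] using hi ⟨p.src.shift p.ν, p.μ⟩
  · simpa [slotInsR] using hi ⟨p.src, p.ν⟩

/-- Each right second insertion is continuous in `U`. [folklore] -/
theorem continuous_slotIns₂R (p : Plaq P j) (i : Fin 4) : Continuous fun U : GaugeField P j G => slotIns₂R ρ u U p i := by
  have hd : ∀ e : PBond P j, Continuous fun U : GaugeField P j G => ρ (U e) * u e * u e :=
    fun e => ((hρ.comp (continuous_apply e)).mul continuous_const).mul continuous_const
  have hi : ∀ e : PBond P j, Continuous fun U : GaugeField P j G => (-u e) * ((-u e) * ρ ((U e)⁻¹)) :=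
    fun e => continuous_const.mul (continuous_const.mul (hρ.comp ((continuous_apply e).inv)))
  fin_cases i
  · simpa [slotIns₂R] using hd ⟨p.src, p.μ⟩
  · simpa [slotIns₂R] using hd ⟨p.src.shift p.μ, p.ν⟩
  · simpa [slotIns₂R] using hi ⟨p.src.shift p.ν, p.μ⟩
  · simpa [slotIns₂R] using hi ⟨p.src, p.ν⟩

/-- The right once-inserted word is continuous in `U`. [folklore] -/
theorem continuous_word_insR (p : Plaq P j) (i : Fin 4) :
    Continuous fun U : GaugeField P j G => word (Function.update (slot ρ U p) i (slotInsR ρ u U p i)) := by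
  refine continuous_word_comp (S := fun U => Function.update (slot ρ U p) i (slotInsR ρ u U p i)) fun l => ?_
  by_cases hl : l = i
  · subst hl; simp only [Function.update_self]; exact continuous_slotInsR hρ u p l
  · simp only [Function.update_of_ne hl]; exact continuous_slot hρ p l

/-- The right double-insertion words are continuous in `U`. [folklore] -/
theorem continuous_word₂R (p : Plaq P j) (i l : Fin 4) : Continuous fun U : GaugeField P j G => word₂R ρ u U p i l := by
  unfold word₂R
  refine continuous_word_comp
    (S := fun U => Function.update (Function.update (slot ρ U p) i (slotInsR ρ u U p i)) l
      (if l = i then slotIns₂R ρ u U p i else slotInsR ρ u U p l)) fun m => ?_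
  by_cases hm : m = l
  · subst hm
    simp only [Function.update_self]
    split_ifs with h
    · exact continuous_slotIns₂R hρ u p i
    · exact continuous_slotInsR hρ u p m
  · simp only [Function.update_of_ne hm]
    by_cases hmi : m = i
    · subst hmi; simp only [Function.update_self]; exact continuous_slotInsR hρ u p m
    · simp only [Function.update_of_ne hmi]; exact continuous_slot hρ p m

/-- `X^R_u` is continuous in `U`. [folklore] -/
theorem continuous_actionDerivR : Continuous fun U : GaugeField P j G => actionDerivR ρ u U := by
  unfold actionDerivR
  refine continuous_finsetSum _ fun p _ => continuous_finsetSum _ fun i _ => ?_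
  exact continuous_negReTrDiv (continuous_word_insR hρ u p i)

/-- `actionDeriv₂R` is continuous in `U`. [folklore] -/
theorem continuous_actionDeriv₂R : Continuous fun U : GaugeField P j G => actionDeriv₂R ρ u U := by
  unfold actionDeriv₂R
  refine continuous_finsetSum _ fun p _ => continuous_finsetSum _ fun i _ => continuous_finsetSum _ fun l _ => ?_
  exact continuous_negReTrDiv (continuous_word₂R hρ u p i l)

variable [DecidableEq (PBond P j)]

/-- The one-bond right rows `A′^R_b` are continuous in `U`. [folklore] -/
theorem continuous_oneBondDerivR (b : PBond P j) : Continuous fun U : GaugeField P j G => oneBondDerivR ρ u b U := by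
  unfold oneBondDerivR
  refine continuous_finsetSum _ fun p _ => continuous_finsetSum _ fun i _ => ?_
  split_ifs
  · exact continuous_negReTrDiv (continuous_word_insR hρ u p i)
  · exact continuous_const

/-- The one-bond right rows `X′^R_b` are continuous in `U`. [folklore] -/
theorem continuous_oneBondDeriv₂R (b : PBond P j) : Continuous fun U : GaugeField P j G => oneBondDeriv₂R ρ u b U := by
  unfold oneBondDeriv₂R
  refine continuous_finsetSum _ fun p _ => continuous_finsetSum _ fun i _ => continuous_finsetSum _ fun l _ => ?_
  split_ifs
  · exact continuous_negReTrDiv (continuous_word₂R hρ u p i l)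
  · exact continuous_const

end Continuity

/-! ## §6 `SU(N)`: the right flow IS Node00's `expChart` -/

section SpecialUnitary

open T4AdjointCovarianceUnitary (lieSU expSU coe_expSU)
open Literature.MathematicalPhysics.QuantumFieldTheory.Balaban1983to89.Node00 (expChart)
open Summit.QuantumFields.YangMills.Theorems.UnitScaleGibbsActionDerivativeFlowHessian (fundamentalRep_expSU_smul reTr_eq_fundamentalRep)

variable {N : ℕ} [NeZero N] {P : Params} {j : ℕ}

omit [NeZero N] in
/-- The rays `t ↦ expSU (t • Y)` are multiplicative (private twin of the tree's `TubeStart.expSU_add_smul`). [cite: Balaban1985BackgroundPropagators, (3.1)–(3.2) p.390] -/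
private theorem expSU_smul_flowR (Y : lieSU (Fin N)) (s t : ℝ) : expSU ((s + t) • Y) = expSU (s • Y) * expSU (t • Y) := by
  apply Subtype.ext
  change NormedSpace.exp (((s + t) • Y : lieSU (Fin N)) : Matrix (Fin N) (Fin N) ℂ) =
    NormedSpace.exp ((s • Y : lieSU (Fin N)) : Matrix (Fin N) (Fin N) ℂ) * NormedSpace.exp ((t • Y : lieSU (Fin N)) : Matrix (Fin N) (Fin N) ℂ)
  rw [Submodule.coe_smul, Submodule.coe_smul, Submodule.coe_smul, add_smul]
  exact Matrix.exp_add_of_commute _ _ (((Commute.refl (Y : Matrix (Fin N) (Fin N) ℂ)).smul_left s).smul_right t)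

omit [NeZero N] in
/-- The right flow at `k b t = expSU (t • Y b)` is `Node00.expChart U (t • Y)`. [cite: Balaban1985RegularSpaces, (1.10) p.77] -/
theorem flow_right_eq_expChart (U : GaugeField P j (Matrix.specialUnitaryGroup (Fin N) ℂ)) (Y : PBond P j → lieSU (Fin N)) (t : ℝ) :
    (fun e => U e * expSU (t • Y e)) = expChart U (t • Y) := by
  funext e
  rfl

/-- ★★★ **THE RIGHT DICTIONARY**: `actionDeriv₂R (fundamentalRep (Fin N)) (b ↦ ↑(Y b)) U = deriv (deriv (t ↦ A(expChart U (t•Y)))) 0` — this seat's summed right Hessian IS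
Node00's right-chart second variation `Q_U(Y)` (the currency of ✓ `UnitScaleGibbsOnEventHessianAxialGauge` §5 and of ✓ `Node00.abs_deriv_deriv_wilsonAction4_expChart_sub_flat_le_local`).
[cite: Balaban1985BackgroundPropagators, (3.6)–(3.7) p.391; GrossCMP1983, Thm 2.2 (proof)] -/
theorem actionDeriv₂R_eq_deriv_deriv_expChart (U : GaugeField P j (Matrix.specialUnitaryGroup (Fin N) ℂ)) (Y : PBond P j → lieSU (Fin N)) :
    actionDeriv₂R (fundamentalRep (Fin N)) (fun b => (Y b : Matrix (Fin N) (Fin N) ℂ)) U =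
      deriv (deriv fun t : ℝ => wilsonAction4 (expChart U (t • Y))) 0 := by
  have h := deriv_deriv_wilsonAction4_flow_right (ρ := fundamentalRep (Fin N)) (u := fun b => (Y b : Matrix (Fin N) (Fin N) ℂ))
    (k := fun b t => expSU (t • Y b)) reTr_eq_fundamentalRep (fun b s t => expSU_smul_flowR (Y b) s t)
    (fun b t => fundamentalRep_expSU_smul (Y b) t) U
  simp only [flow_right_eq_expChart] at h
  exact h.symm

/-- ★★ The first-order right dictionary: `actionDerivR (fundamentalRep (Fin N)) (b ↦ ↑(Y b)) U = deriv (t ↦ A(expChart U (t•Y))) 0`. [cite: Balaban1985BackgroundPropagators, (3.6) p.391] -/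
theorem actionDerivR_eq_deriv_expChart (U : GaugeField P j (Matrix.specialUnitaryGroup (Fin N) ℂ)) (Y : PBond P j → lieSU (Fin N)) :
    actionDerivR (fundamentalRep (Fin N)) (fun b => (Y b : Matrix (Fin N) (Fin N) ℂ)) U =
      deriv (fun t : ℝ => wilsonAction4 (expChart U (t • Y))) 0 := by
  have h := deriv_wilsonAction4_flow_right_zero (ρ := fundamentalRep (Fin N)) (u := fun b => (Y b : Matrix (Fin N) (Fin N) ℂ))
    (k := fun b t => expSU (t • Y b)) reTr_eq_fundamentalRep (fun b s t => expSU_smul_flowR (Y b) s t)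
    (fun b t => fundamentalRep_expSU_smul (Y b) t) U
  simp only [flow_right_eq_expChart] at h
  exact h.symm

end SpecialUnitary

end Summit.QuantumFields.YangMills.Theorems.UnitScaleGibbsActionDerivativeSlotCalculusRight

end
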